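import Literature.Probability.RandomPlanarGeometry.SAWCountZdSymbolThirdLowerCount
import HarnessLib

/-!
# THE FOURTH-LAYER LOWEST CENSUS: `M_j(2j−3, 2j−6) = (2j−6)·Q_j·2^{2j−5}` for every `j ≥ 5` — partitions of `2k + 3` points into `k` blocks, and up to three tripled block letters

Topic `Literature/Probability/RandomPlanarGeometry` (the «SYMBOL POLYNOMIALITY» programme, FOURTH layer — first corner; on `SAWCountZdSymbolThirdLowerCount.lean` (a-p1 g27: (G3)
`card_twoParts_of_card_eq_add_two`, `two_mul_card_twoTriples`, `card_twoParts_filter_quad`, `quadOf`, `blocks_of_mem_twoParts_add_two`), `SAWCountZdSymbolSecondLowerCount.lean`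
(a-p1 g26: `twoParts`, (G1)/(G2), the (A, B, ρ) data `abData`, ★★ `card_goodParts_eq_card_abData`, `card_outerPos`), `SAWCountZdSymbolBlockData.lean` (the one-block bijection
`card_shapeClass_topVec`), λ1 (`exists_eq_topVec_of_mem_shapeClass`, `topVec_injOn`)).

PRINTED CONTEXT (locators only; nothing is quoted digit-for-digit). Madras–Slade (1993) §1.1 eq. (1.1.8) p. 5, Definition 1.2.4, §1.2 p. 10; Clisby–Liang–Slade (2007)
§3.3 eqs. (29)/(31); Glimm–Jaffe (1987) (3.2.13); Stanley EC1 §1.3 (set partitions with prescribed block sizes). NOT IN PRINT as far as the lane's desks could locate: the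
statements below.

THE THEOREM. The FOURTH layer of the symbol polynomial `R_j` (the coefficient `[X^{2j−6}] R_j`, FINDING-ZD-SYMBOL-POLYNOMIALITY §18/§20 (v)) has four corners `u = 2j, …, 2j−3`
with `2j − 6` breaks; the LOWEST one, `u = 2j − 3`, consists of the one-block classes `topVec (2j−3) p` (λ1), each of size `#goodParts (2j−3) j p · 2^{2j−5}`, and in (A, B, ρ)
coordinates on the `2j − 7 = 2k + 3` outside positions (`k = j − 5` further blocks) `#goodParts` is the (A, B) sum of `#twoParts (outside ∖ (A ∪ B)) k` — now `#A + #B ≤ 3`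
survives. HERE: (G4) ★★ `card_twoParts_of_card_eq_add_three` — on `2k + 3` points the partitions into `k` blocks of size `≥ 2` number
**`C(2k+3,5)(2k−3)‼ + C(2k+3,4)·C(2k−1,3)(2k−5)‼ + 280·C(2k+3,9)(2k−7)‼`** (★ `blocks_of_mem_twoParts_add_three`: excess three = one QUINTUPLE, or a QUADRUPLE and a TRIPLE, or
THREE TRIPLES — the last counted thrice by (marked triple, two-triple partition of the rest): `three_mul_card_threeTriples`); ★★ `sum_card_twoParts_pairs_add_three` — the (A, B) sum on
`2k + 3` points (`#A + #B = 3` gives `8·C(2k+3,3)` copies of `(2k−1)‼`: `card_disjPairs_three`); hence ★★★ `card_shapeClass_fourthLow`: **`#shapeClass j (2j−3) (topVec (2j−3) p)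
= Q_j·2^{2j−5}`** with `Q_j = fourthLowQ j` (`8, 131, 2086, 35938` for `j = 5…8`), and ★★★ `fourthShapeSumLow_eq`: **`M_j(2j−3, 2j−6) = (2j−6)·Q_j·2^{2j−5}` for every
`j ≥ 5`** —
`1024, 100608, 8 544 256, 736 010 240` for `j = 5, 6, 7, 8`, the last two ≡ the lane's full censuses (FINDING §18: `M_7(11,8)`, `M_8(13,10)`). Tool notions (the lane's):
`quintData`, `quintOf`, `fourthLowQ`, `fourthShapeSumLow`.

THIS FILE (lane «pcv-sawmu», a-p1 g27; all PROVED, standard axioms): ★ `blocks_of_mem_twoParts_add_three`, `quintData`, `quintOf`, `quintOf_eq`, ★ `card_twoParts_filter_quint`,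
`quadOf_eq_of_forall`,
★ `card_twoParts_filter_quad_three`, ★ `three_mul_card_threeTriples`, `choose_three_three_three` (private), ★★ `card_twoParts_of_card_eq_add_three`, `card_disjPairs_four_choose` (private),
`card_disjPairs_three` (private), ★★ `sum_card_twoParts_pairs_add_three`, `fourthLowQ`, ★★ `card_abData_fourthLow`, ★★★ `card_shapeClass_fourthLow`, `fourthShapeSumLow`,
★★★ `fourthShapeSumLow_eq`, `fourthShapeSumLow_values`.
[cite: MadrasSlade1993, §1.1 eq. (1.1.8) p. 5; Definition 1.2.4; §1.2 (p. 10)] [cite: ClisbyLiangSlade2007, §3.3 eqs. (29)/(31)] [cite: GlimmJaffeQP1987, (3.2.13) §3.2]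
[cite: Stanley2012EC1, §1.3]

Provenance: lane «pcv-sawmu», a-p1 g27 (2026-08-28).
-/

open Finset
open scoped BigOperators
open Literature.Probability.LatticeModels
open Literature.Probability.RandomPlanarGeometry.SAW
open Literature.Probability.Percolation
open Literature.MathematicalPhysics.QuantumFieldTheory.Balaban1983to89
open Literature.MathematicalPhysics.QuantumFieldTheory.Balaban1983to89.HiggsFluctMeasureWickPairings

namespace Literature.Probability.RandomPlanarGeometry.SAW.Zd

namespace WordTypes

variable {m : ℕ}

/-! ### (G4) `2k + 3` elements: a quintuple, a quadruple and a triple, or three triples -/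

/-- ★ In `ρ ∈ twoParts W k` with `#W = 2k + 3` (excess three): either one block has size `5` and the others size `2`; or one block has size `4`, it is the only one, and the
blocks of size `≠ 2, 4` are exactly one triple; or all blocks have size `≤ 3` and exactly three have size `3`. [cite: Stanley2012EC1, §1.3; lane lemma] -/
theorem blocks_of_mem_twoParts_add_three {W : Finset (Fin m)} {k : ℕ} (hW : W.card = 2 * k + 3) {ρ : Finset (Finset (Fin m))} (h : ρ ∈ twoParts W k) :
    (∃ Q ∈ ρ, Q.card = 5 ∧ ∀ B ∈ ρ, B ≠ Q → B.card = 2) ∨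
    (∃ Q ∈ ρ, Q.card = 4 ∧ (∀ B ∈ ρ, B.card = 4 → B = Q) ∧ (∀ B ∈ ρ, B.card ≤ 4) ∧ ((ρ.erase Q).filter fun B => B.card = 3).card = 1 ∧
      ∀ B ∈ ρ.erase Q, B.card ≤ 3) ∨
    ((∀ B ∈ ρ, B.card ≤ 3) ∧ (ρ.filter fun B => B.card = 3).card = 3) := by
  classical
  have hsum := sum_card_sub_two_of_mem_twoParts h
  rw [mem_twoParts] at h
  obtain ⟨-, h2, -⟩ := h
  have hs : ∑ B ∈ ρ, (B.card - 2) = 3 := by omega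
  have hle : ∀ B ∈ ρ, B.card - 2 ≤ 3 := fun B hB => by
    have := Finset.single_le_sum (f := fun B : Finset (Fin m) => B.card - 2) (fun _ _ => Nat.zero_le _) hB; omega
  -- two distinct blocks contribute at most the total
  have hpair : ∀ Q ∈ ρ, ∀ B ∈ ρ, B ≠ Q → Q.card - 2 + (B.card - 2) ≤ 3 := by
    intro Q hQ B hB hBQ
    rw [← hs, ← Finset.sum_pair (f := fun B : Finset (Fin m) => B.card - 2) hBQ.symm]
    exact Finset.sum_le_sum_of_subset_of_nonneg (fun x hx => by
      rw [Finset.mem_insert, Finset.mem_singleton] at hx; rcases hx with rfl | rfl <;> assumption) (fun _ _ _ => Nat.zero_le _)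
  by_cases h5 : ∃ Q ∈ ρ, Q.card = 5
  · obtain ⟨Q, hQ, hQ5⟩ := h5
    refine Or.inl ⟨Q, hQ, hQ5, fun B hB hBQ => ?_⟩
    have := hpair Q hQ B hB hBQ; have := h2 B hB; omega
  by_cases h4 : ∃ Q ∈ ρ, Q.card = 4
  · obtain ⟨Q, hQ, hQ4⟩ := h4
    push Not at h5
    have hle4 : ∀ B ∈ ρ, B.card ≤ 4 := fun B hB => by have := hle B hB; have := h5 B hB; omega
    have huq : ∀ B ∈ ρ, B.card = 4 → B = Q := by
      intro B hB hB4; by_contra hne; have := hpair Q hQ B hB hne; omega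
    have hrest3 : ∀ B ∈ ρ.erase Q, B.card ≤ 3 := by
      intro B hB
      have hBρ := Finset.mem_of_mem_erase hB
      have := hle4 B hBρ
      rcases Nat.lt_or_ge B.card 4 with h | h
      · omega
      · exact absurd (huq B hBρ (by omega)) (Finset.ne_of_mem_erase hB)
    refine Or.inr (Or.inl ⟨Q, hQ, hQ4, huq, hle4, ?_, hrest3⟩)
    -- the excess on `ρ.erase Q` is `1`
    have hs' : ∑ B ∈ ρ.erase Q, (B.card - 2) = 1 := by
      have := Finset.sum_erase_add ρ (fun B : Finset (Fin m) => B.card - 2) hQ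
      rw [hs, hQ4] at this; omega
    have hterm : ∀ B ∈ ρ.erase Q, B.card - 2 = if B.card = 3 then 1 else 0 := fun B hB => by
      have := h2 B (Finset.mem_of_mem_erase hB); have := hrest3 B hB; split_ifs <;> omega
    rw [Finset.sum_congr rfl hterm, Finset.sum_boole] at hs'
    exact_mod_cast hs'
  · push Not at h5 h4
    have h3 : ∀ B ∈ ρ, B.card ≤ 3 := fun B hB => by
      have := hle B hB; have := h5 B hB; have := h4 B hB; omega
    refine Or.inr (Or.inr ⟨h3, ?_⟩)
    have hterm : ∀ B ∈ ρ, B.card - 2 = if B.card = 3 then 1 else 0 := fun B hB => by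
      have := h2 B hB; have := h3 B hB; split_ifs <;> omega
    rw [Finset.sum_congr rfl hterm, Finset.sum_boole] at hs
    exact_mod_cast hs

open Classical in
/-- The quintuple data: a `5`-subset `t ⊆ W` and a perfect matching of `W ∖ t`. [cite: Stanley2012EC1, §1.3; lane tool notion] -/
noncomputable def quintData (W : Finset (Fin m)) : Finset (Σ _ : Finset (Fin m), Finset (Finset (Fin m))) :=
  (W.powersetCard 5).sigma fun t => pairPartitions (W \ t)

open Classical in
/-- The unique quintuple of `ρ` (junk `∅` if none). [cite: Stanley2012EC1, §1.3; lane tool notion] -/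
noncomputable def quintOf (ρ : Finset (Finset (Fin m))) : Finset (Fin m) :=
  if h : ∃ T ∈ ρ, T.card = 5 then h.choose else ∅

/-- `quintOf ρ` is the size-5 block when there is exactly one. [cite: Stanley2012EC1, §1.3; lane plumbing] -/
theorem quintOf_eq {ρ : Finset (Finset (Fin m))} {T : Finset (Fin m)} (hT : T ∈ ρ) (hT5 : T.card = 5) (huniq : ∀ B ∈ ρ, B ≠ T → B.card = 2) :
    quintOf ρ = T := by
  classical
  have hex : ∃ T ∈ ρ, T.card = 5 := ⟨T, hT, hT5⟩
  unfold quintOf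
  rw [dif_pos hex]
  by_contra hne
  have := huniq _ hex.choose_spec.1 hne
  have := hex.choose_spec.2
  omega

open Classical in
/-- ★ The partitions with a quintuple: `#{ρ ∈ twoParts W k | ∃ Q ∈ ρ, #Q = 5} = C(2k+3, 5)·(2k−3)‼` (`#W = 2k + 3`). [cite: Stanley2012EC1, §1.3; lane lemma] -/
theorem card_twoParts_filter_quint {W : Finset (Fin m)} {k : ℕ} (hW : W.card = 2 * k + 3) :
    ((twoParts W k).filter fun ρ => ∃ Q ∈ ρ, Q.card = 5).card = (2 * k + 3).choose 5 * (2 * k - 3).doubleFactorial := by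
  have htarget : (quintData W).card = (2 * k + 3).choose 5 * (2 * k - 3).doubleFactorial := by
    unfold quintData
    rw [Finset.card_sigma, Finset.sum_const_nat (m := (2 * k - 3).doubleFactorial), Finset.card_powersetCard, hW]
    intro t ht
    rw [Finset.mem_powersetCard] at ht
    rcases Nat.lt_or_ge k 1 with hk | hk
    · exfalso; have := Finset.card_le_card ht.1; omega
    · rw [card_pairPartitions_of_card_eq_two_mul (n := k - 1) (by rw [Finset.card_sdiff_of_subset ht.1, hW, ht.2]; omega)]
      congr 1; omega
  rw [← htarget]
  have key : ∀ ρ ∈ (twoParts W k).filter (fun ρ => ∃ Q ∈ ρ, Q.card = 5), ∃ Q ∈ ρ, Q.card = 5 ∧ (∀ B ∈ ρ, B ≠ Q → B.card = 2) := by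
    intro ρ hρ
    rw [Finset.mem_filter] at hρ
    rcases blocks_of_mem_twoParts_add_three hW hρ.1 with h | ⟨Q, hQ, hQ4, -, hle4, -⟩ | ⟨h3, -⟩
    · exact h
    · exfalso; obtain ⟨Q', hQ', hQ5⟩ := hρ.2; have := hle4 Q' hQ'; omega
    · exfalso; obtain ⟨Q', hQ', hQ5⟩ := hρ.2; have := h3 Q' hQ'; omega
  refine Finset.card_nbij' (fun ρ => ⟨quintOf ρ, ρ.erase (quintOf ρ)⟩) (fun d => insert d.1 d.2) (fun ρ hρ => ?_) (fun d hd => ?_) (fun ρ hρ => ?_) (fun d hd => ?_)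
  · rw [Finset.mem_coe] at hρ
    obtain ⟨Q, hQ, hQ5, hu⟩ := key ρ hρ
    have hρ' := (mem_twoParts.1 (Finset.mem_filter.1 hρ).1).1
    dsimp only
    rw [quintOf_eq hQ hQ5 hu]
    unfold quintData
    rw [Finset.mem_coe, Finset.mem_sigma, Finset.mem_powersetCard, mem_pairPartitions]
    exact ⟨⟨hρ'.subset hQ, hQ5⟩, hρ'.erase hQ, fun B hB => hu B (Finset.mem_of_mem_erase hB) (Finset.ne_of_mem_erase hB)⟩
  · obtain ⟨t, σ⟩ := d
    unfold quintData at hd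
    rw [Finset.mem_coe, Finset.mem_sigma, Finset.mem_powersetCard, mem_pairPartitions] at hd
    obtain ⟨⟨htW, ht5⟩, hσ, hσ2⟩ := hd
    dsimp only at htW ht5 hσ hσ2 ⊢
    have hins : IsSetPartition W (insert t σ) := hσ.insert htW (by rw [← Finset.card_pos, ht5]; norm_num)
    have htσ : t ∉ σ := hσ.notMem_of_sdiff (by rw [← Finset.card_pos, ht5]; norm_num)
    rw [Finset.mem_coe, Finset.mem_filter, mem_twoParts]
    refine ⟨⟨hins, fun B hB => ?_, ?_⟩, t, Finset.mem_insert_self _ _, ht5⟩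
    · rcases Finset.mem_insert.1 hB with hBt | hB
      · rw [hBt, ht5]; norm_num
      · rw [hσ2 B hB]
    · rw [Finset.card_insert_of_notMem htσ]
      have := card_eq_two_mul_of_mem_pairPartitions (mem_pairPartitions.2 ⟨hσ, hσ2⟩)
      rw [Finset.card_sdiff_of_subset htW, hW, ht5] at this
      have := Finset.card_le_card htW
      rw [hW, ht5] at this
      omega
  · rw [Finset.mem_coe] at hρ
    obtain ⟨Q, hQ, hQ5, hu⟩ := key ρ hρ
    simp only [quintOf_eq hQ hQ5 hu, Finset.insert_erase hQ]
  · obtain ⟨t, σ⟩ := d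
    unfold quintData at hd
    rw [Finset.mem_coe, Finset.mem_sigma, Finset.mem_powersetCard, mem_pairPartitions] at hd
    obtain ⟨⟨htW, ht5⟩, hσ, hσ2⟩ := hd
    dsimp only at htW ht5 hσ hσ2 ⊢
    have htσ : t ∉ σ := hσ.notMem_of_sdiff (by rw [← Finset.card_pos, ht5]; norm_num)
    have htr : quintOf (insert t σ) = t :=
      quintOf_eq (Finset.mem_insert_self _ _) ht5 (fun B hB hBt => by
        rcases Finset.mem_insert.1 hB with rfl | hB
        · exact absurd rfl hBt
        · exact hσ2 B hB)
    simp only [htr, Finset.erase_insert htσ]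

/-- The chosen quadruple is the unique block of size four. [cite: Stanley2012EC1, §1.3; lane plumbing] -/
theorem quadOf_eq_of_forall {ρ : Finset (Finset (Fin m))} {T : Finset (Fin m)} (hT : T ∈ ρ) (hT4 : T.card = 4) (huniq : ∀ B ∈ ρ, B.card = 4 → B = T) : quadOf ρ = T := by
  classical
  have hex : ∃ T ∈ ρ, T.card = 4 := ⟨T, hT, hT4⟩
  unfold quadOf
  rw [dif_pos hex]
  exact huniq _ hex.choose_spec.1 hex.choose_spec.2

open Classical in
/-- ★ The partitions with a quadruple (and hence one triple): `#{ρ ∈ twoParts W k | ∃ Q ∈ ρ, #Q = 4} = C(2k+3, 4)·C(2k−1, 3)·(2k−5)‼` (`#W = 2k + 3`) — erase the quadruple,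
a (G2)-partition of the remaining `2k − 1` points. [cite: Stanley2012EC1, §1.3; lane lemma] -/
theorem card_twoParts_filter_quad_three {W : Finset (Fin m)} {k : ℕ} (hW : W.card = 2 * k + 3) :
    ((twoParts W k).filter fun ρ => ∃ Q ∈ ρ, Q.card = 4).card = (2 * k + 3).choose 4 * ((2 * k - 1).choose 3 * (2 * k - 5).doubleFactorial) := by
  rcases Nat.lt_or_ge k 1 with hk | hk
  · have hk0 : k = 0 := by omega
    subst hk0
    have : (twoParts W 0).filter (fun ρ => ∃ Q ∈ ρ, Q.card = 4) = ∅ := by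
      rw [Finset.filter_eq_empty_iff]
      rintro ρ hρ ⟨Q, hQ, -⟩
      rw [mem_twoParts] at hρ
      rw [Finset.card_eq_zero.1 hρ.2.2] at hQ
      simp at hQ
    rw [this, Finset.card_empty]; decide
  have htarget : ((W.powersetCard 4).sigma fun t => twoParts (W \ t) (k - 1)).card = (2 * k + 3).choose 4 * ((2 * k - 1).choose 3 * (2 * k - 5).doubleFactorial) := by
    rw [Finset.card_sigma, Finset.sum_const_nat (m := (2 * k - 1).choose 3 * (2 * k - 5).doubleFactorial), Finset.card_powersetCard, hW]
    intro t ht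
    rw [Finset.mem_powersetCard] at ht
    rw [card_twoParts_of_card_eq_succ (k := k - 1) (by rw [Finset.card_sdiff_of_subset ht.1, hW, ht.2]; omega)]
    have e1 : 2 * (k - 1) + 1 = 2 * k - 1 := by omega
    have e2 : 2 * (k - 1) - 3 = 2 * k - 5 := by omega
    rw [e1, e2]
  rw [← htarget]
  refine Finset.card_nbij' (fun ρ => ⟨quadOf ρ, ρ.erase (quadOf ρ)⟩) (fun d => insert d.1 d.2) (fun ρ hρ => ?_) (fun d hd => ?_) (fun ρ hρ => ?_) (fun d hd => ?_)
  · rw [Finset.mem_coe, Finset.mem_filter] at hρ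
    obtain ⟨hρ, hex⟩ := hρ
    rcases blocks_of_mem_twoParts_add_three hW hρ with ⟨Q, hQ, hQ5, hu⟩ | ⟨Q, hQ, hQ4, huq, -, -, -⟩ | ⟨h3, -⟩
    · exfalso; obtain ⟨Q', hQ', hQ4⟩ := hex
      by_cases hqq : Q' = Q
      · rw [hqq, hQ5] at hQ4; omega
      · have := hu Q' hQ' hqq; omega
    · have hρ' := mem_twoParts.1 hρ
      dsimp only
      rw [quadOf_eq_of_forall hQ hQ4 huq, Finset.mem_coe, Finset.mem_sigma, Finset.mem_powersetCard, mem_twoParts]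
      exact ⟨⟨hρ'.1.subset hQ, hQ4⟩, hρ'.1.erase hQ, fun B hB => hρ'.2.1 B (Finset.mem_of_mem_erase hB), by rw [Finset.card_erase_of_mem hQ, hρ'.2.2]⟩
    · exfalso; obtain ⟨Q, hQ, hQ4⟩ := hex; have := h3 Q hQ; omega
  · obtain ⟨t, σ⟩ := d
    rw [Finset.mem_coe, Finset.mem_sigma, Finset.mem_powersetCard, mem_twoParts] at hd
    obtain ⟨⟨htW, ht4⟩, hσ, hσ2, hσk⟩ := hd
    dsimp only at htW ht4 hσ hσ2 hσk ⊢
    have hins : IsSetPartition W (insert t σ) := hσ.insert htW (by rw [← Finset.card_pos, ht4]; norm_num)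
    have htσ : t ∉ σ := hσ.notMem_of_sdiff (by rw [← Finset.card_pos, ht4]; norm_num)
    rw [Finset.mem_coe, Finset.mem_filter, mem_twoParts]
    refine ⟨⟨hins, fun B hB => ?_, by rw [Finset.card_insert_of_notMem htσ, hσk]; omega⟩, t, Finset.mem_insert_self _ _, ht4⟩
    rcases Finset.mem_insert.1 hB with hBt | hB
    · rw [hBt, ht4]; norm_num
    · exact hσ2 B hB
  · rw [Finset.mem_coe, Finset.mem_filter] at hρ
    obtain ⟨hρ, hex⟩ := hρ
    obtain ⟨Q, hQ, hQ4⟩ := hex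
    rcases blocks_of_mem_twoParts_add_three hW hρ with ⟨Q', hQ', hQ5, hu⟩ | ⟨Q', hQ', hQ4', huq, -⟩ | ⟨h3, -⟩
    · exfalso
      by_cases hqq : Q = Q'
      · rw [hqq, hQ5] at hQ4; omega
      · have := hu Q hQ hqq; omega
    · simp only [quadOf_eq_of_forall hQ' hQ4' huq, Finset.insert_erase hQ']
    · exfalso; have := h3 Q hQ; omega
  · obtain ⟨t, σ⟩ := d
    rw [Finset.mem_coe, Finset.mem_sigma, Finset.mem_powersetCard, mem_twoParts] at hd
    obtain ⟨⟨htW, ht4⟩, hσ, hσ2, hσk⟩ := hd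
    dsimp only at htW ht4 hσ hσ2 hσk ⊢
    have htσ : t ∉ σ := hσ.notMem_of_sdiff (by rw [← Finset.card_pos, ht4]; norm_num)
    have hWt : (W \ t).card = 2 * (k - 1) + 1 := by rw [Finset.card_sdiff_of_subset htW, hW, ht4]; omega
    obtain ⟨T, hT, hT3, hTu⟩ := exists_unique_triple_of_mem_twoParts hWt (mem_twoParts.2 ⟨hσ, hσ2, hσk⟩)
    have htr : quadOf (insert t σ) = t :=
      quadOf_eq_of_forall (Finset.mem_insert_self _ _) ht4 (fun B hB hB4 => by
        rcases Finset.mem_insert.1 hB with h | h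
        · exact h
        · exfalso
          by_cases hBT : B = T
          · rw [hBT, hT3] at hB4; omega
          · rw [hTu B h hBT] at hB4; omega)
    simp only [htr, Finset.erase_insert htσ]

open Classical in
/-- ★ THE THREE-TRIPLE PARTITIONS, counted thrice: `3·#{ρ | all blocks ≤ 3} = C(2k+3,3)·#{two-triple partitions of 2k points}` (`#W = 2k + 3`, `k ≥ 2`) — the map
(marked triple, two-triple partition of the rest) ↦ insert is three-to-one. [cite: Stanley2012EC1, §1.3; lane lemma] -/
theorem three_mul_card_threeTriples {W : Finset (Fin m)} {k : ℕ} (hW : W.card = 2 * k + 3) (hk : 2 ≤ k) :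
    3 * ((twoParts W k).filter fun ρ => ∀ B ∈ ρ, B.card ≤ 3).card =
      (2 * k + 3).choose 3 * (10 * (2 * k).choose 6 * (2 * k - 7).doubleFactorial) := by
  set P := (twoParts W k).filter fun ρ => ∀ B ∈ ρ, B.card ≤ 3 with hP
  set src := (W.powersetCard 3).sigma fun t => (twoParts (W \ t) (k - 1)).filter fun ρ => ¬ ∃ Q ∈ ρ, Q.card = 4 with hsrc
  -- the count of the source: the two-triple partitions of `2k = 2(k−1)+2` points
  have hsrc_card : src.card = (2 * k + 3).choose 3 * (10 * (2 * k).choose 6 * (2 * k - 7).doubleFactorial) := by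
    rw [hsrc, Finset.card_sigma, Finset.sum_const_nat (m := 10 * (2 * k).choose 6 * (2 * k - 7).doubleFactorial), Finset.card_powersetCard, hW]
    intro t ht
    rw [Finset.mem_powersetCard] at ht
    have hWt : (W \ t).card = 2 * (k - 1) + 2 := by rw [Finset.card_sdiff_of_subset ht.1, hW, ht.2]; omega
    have h2 := two_mul_card_twoTriples hWt (by omega)
    have e1 : 2 * (k - 1) + 2 = 2 * k := by omega
    have e2 : 2 * (k - 1) - 1 = 2 * k - 3 := by omega
    have e3 : 2 * (k - 1) - 5 = 2 * k - 7 := by omega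
    rw [e1, e2, e3] at h2
    have h20 : (2 * k).choose 3 * (2 * k - 3).choose 3 = 20 * (2 * k).choose 6 := by
      have h := Nat.choose_mul (n := 2 * k) (k := 6) (s := 3) (by norm_num)
      rw [show Nat.choose 6 3 = 20 by decide, show 6 - 3 = 3 by norm_num] at h
      rw [← h, mul_comm]
    have : 2 * ((twoParts (W \ t) (k - 1)).filter fun ρ => ¬ ∃ Q ∈ ρ, Q.card = 4).card = 2 * (10 * (2 * k).choose 6 * (2 * k - 7).doubleFactorial) := by
      rw [h2, ← mul_assoc, h20]; ring
    omega
  -- the map and its fibres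
  have hmem : ∀ d ∈ src, insert d.1 d.2 ∈ P ∧ d.1 ∉ d.2 ∧ d.1.card = 3 := by
    intro d hd
    obtain ⟨t, σ⟩ := d
    rw [hsrc, Finset.mem_sigma, Finset.mem_powersetCard, Finset.mem_filter] at hd
    obtain ⟨⟨htW, ht3⟩, hσ, hnq⟩ := hd
    dsimp only at htW ht3 hσ hnq ⊢
    have hWt : (W \ t).card = 2 * (k - 1) + 2 := by rw [Finset.card_sdiff_of_subset htW, hW, ht3]; omega
    rcases blocks_of_mem_twoParts_add_two hWt hσ with ⟨Q, hQ, hQ4, -⟩ | ⟨h3, -⟩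
    · exact absurd ⟨Q, hQ, hQ4⟩ hnq
    · rw [mem_twoParts] at hσ
      obtain ⟨hσp, hσ2, hσk⟩ := hσ
      have htσ : t ∉ σ := hσp.notMem_of_sdiff (by rw [← Finset.card_pos, ht3]; norm_num)
      have hins : IsSetPartition W (insert t σ) := hσp.insert htW (by rw [← Finset.card_pos, ht3]; norm_num)
      refine ⟨?_, htσ, ht3⟩
      rw [hP, Finset.mem_filter, mem_twoParts]
      refine ⟨⟨hins, fun B hB => ?_, by rw [Finset.card_insert_of_notMem htσ, hσk]; omega⟩, fun B hB => ?_⟩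
      · rcases Finset.mem_insert.1 hB with hBt | hB
        · rw [hBt, ht3]; norm_num
        · exact hσ2 B hB
      · rcases Finset.mem_insert.1 hB with hBt | hB
        · rw [hBt, ht3]
        · exact h3 B hB
  have hmaps : Set.MapsTo (fun d : (Σ _ : Finset (Fin m), Finset (Finset (Fin m))) => insert d.1 d.2) ↑src ↑P := fun d hd => (hmem d hd).1
  have hfib := Finset.card_eq_sum_card_fiberwise hmaps
  have hfib3 : ∀ ρ ∈ P, (src.filter fun d => insert d.1 d.2 = ρ).card = 3 := by
    intro ρ hρ
    rw [hP, Finset.mem_filter] at hρ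
    obtain ⟨hρ, h3⟩ := hρ
    rcases blocks_of_mem_twoParts_add_three hW hρ with ⟨Q, hQ, hQ5, -⟩ | ⟨Q, hQ, hQ4, -⟩ | ⟨-, hthree⟩
    · have := h3 Q hQ; omega
    · have := h3 Q hQ; omega
    · rw [← hthree]
      have hρ' := (mem_twoParts.1 hρ).1
      have hρ2 := (mem_twoParts.1 hρ).2.1
      have hρk := (mem_twoParts.1 hρ).2.2
      refine Finset.card_nbij' (fun d => d.1) (fun T => ⟨T, ρ.erase T⟩) (fun d hd => ?_) (fun T hT => ?_) (fun d hd => ?_) (fun T hT => ?_)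
      · rw [Finset.mem_coe, Finset.mem_filter] at hd
        obtain ⟨hd, hdρ⟩ := hd
        obtain ⟨-, -, ht3⟩ := hmem d hd
        rw [Finset.mem_coe, Finset.mem_filter]
        exact ⟨by rw [← hdρ]; exact Finset.mem_insert_self _ _, ht3⟩
      · rw [Finset.mem_coe, Finset.mem_filter] at hT
        obtain ⟨hT, hT3⟩ := hT
        rw [Finset.mem_coe, Finset.mem_filter]
        refine ⟨?_, Finset.insert_erase hT⟩
        rw [hsrc, Finset.mem_sigma, Finset.mem_powersetCard, Finset.mem_filter]
        refine ⟨⟨hρ'.subset hT, hT3⟩, mem_twoParts.2 ⟨hρ'.erase hT, fun B hB => hρ2 B (Finset.mem_of_mem_erase hB), by rw [Finset.card_erase_of_mem hT, hρk]⟩, ?_⟩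
        rintro ⟨Q, hQ, hQ4⟩
        have := h3 Q (Finset.mem_of_mem_erase hQ); omega
      · rw [Finset.mem_coe, Finset.mem_filter] at hd
        obtain ⟨hd, hdρ⟩ := hd
        obtain ⟨-, hnot, -⟩ := hmem d hd
        obtain ⟨t, σ⟩ := d
        dsimp only at hdρ hnot ⊢
        simp only [← hdρ, Finset.erase_insert hnot]
      · rfl
  rw [← hsrc_card, hfib, Finset.sum_congr rfl hfib3, Finset.sum_const, smul_eq_mul, mul_comm]

/-- `C(n,3)·(10·C(n−3,6)) = 3·280·C(n,9)`: marking one of three triples. [cite: Stanley2012EC1, §1.3; lane plumbing] -/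
private theorem choose_three_three_three (n : ℕ) : n.choose 3 * (10 * (n - 3).choose 6) = 3 * (280 * n.choose 9) := by
  have h := Nat.choose_mul (n := n) (k := 9) (s := 3) (by norm_num)
  rw [show Nat.choose 9 3 = 84 by decide, show 9 - 3 = 6 by norm_num] at h
  have : n.choose 3 * (n - 3).choose 6 = 84 * n.choose 9 := by rw [← h, mul_comm]
  calc n.choose 3 * (10 * (n - 3).choose 6) = 10 * (n.choose 3 * (n - 3).choose 6) := by ring
    _ = 3 * (280 * n.choose 9) := by rw [this]; ring

open Classical in
/-- ★★ (G4) count: `#twoParts W k = C(2k+3,5)(2k−3)‼ + C(2k+3,4)·C(2k−1,3)(2k−5)‼ + 280·C(2k+3,9)(2k−7)‼` when `#W = 2k + 3`.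
[cite: Stanley2012EC1, §1.3; lane theorem] -/
theorem card_twoParts_of_card_eq_add_three {W : Finset (Fin m)} {k : ℕ} (hW : W.card = 2 * k + 3) :
    (twoParts W k).card = (2 * k + 3).choose 5 * (2 * k - 3).doubleFactorial + (2 * k + 3).choose 4 * ((2 * k - 1).choose 3 * (2 * k - 5).doubleFactorial) +
      280 * (2 * k + 3).choose 9 * (2 * k - 7).doubleFactorial := by
  -- split by the largest block: `5`, `4`, or all `≤ 3`
  have hsplit : twoParts W k = ((twoParts W k).filter fun ρ => ∃ Q ∈ ρ, Q.card = 5) ∪ ((twoParts W k).filter fun ρ => ∃ Q ∈ ρ, Q.card = 4) ∪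
      ((twoParts W k).filter fun ρ => ∀ B ∈ ρ, B.card ≤ 3) := by
    ext ρ
    rw [Finset.mem_union, Finset.mem_union, Finset.mem_filter, Finset.mem_filter, Finset.mem_filter]
    constructor
    · intro hρ
      rcases blocks_of_mem_twoParts_add_three hW hρ with ⟨Q, hQ, hQ5, -⟩ | ⟨Q, hQ, hQ4, -⟩ | ⟨h3, -⟩
      · exact Or.inl (Or.inl ⟨hρ, Q, hQ, hQ5⟩)
      · exact Or.inl (Or.inr ⟨hρ, Q, hQ, hQ4⟩)
      · exact Or.inr ⟨hρ, h3⟩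
    · rintro ((⟨h, -⟩ | ⟨h, -⟩) | ⟨h, -⟩) <;> exact h
  have hd1 : Disjoint ((twoParts W k).filter fun ρ => ∃ Q ∈ ρ, Q.card = 5) ((twoParts W k).filter fun ρ => ∃ Q ∈ ρ, Q.card = 4) := by
    rw [Finset.disjoint_filter]
    rintro ρ hρ ⟨Q, hQ, hQ5⟩ ⟨Q', hQ', hQ4⟩
    rcases blocks_of_mem_twoParts_add_three hW hρ with ⟨P, hP5mem, hP5, hu⟩ | ⟨P, -, -, -, hle4, -⟩ | ⟨h3, -⟩
    · by_cases h : Q' = P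
      · rw [h, hP5] at hQ4; omega
      · have := hu Q' hQ' h; omega
    · have := hle4 Q hQ; omega
    · have := h3 Q hQ; omega
  have hd2 : Disjoint (((twoParts W k).filter fun ρ => ∃ Q ∈ ρ, Q.card = 5) ∪ ((twoParts W k).filter fun ρ => ∃ Q ∈ ρ, Q.card = 4))
      ((twoParts W k).filter fun ρ => ∀ B ∈ ρ, B.card ≤ 3) := by
    rw [Finset.disjoint_left]
    intro ρ h h3
    rw [Finset.mem_filter] at h3
    rcases Finset.mem_union.1 h with h | h <;> rw [Finset.mem_filter] at h <;> obtain ⟨-, Q, hQ, hQc⟩ := h <;> have := h3.2 Q hQ <;> omega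
  rcases Nat.lt_or_ge k 2 with hk | hk
  · -- `k ≤ 1`: no three triples (they need `k ≥ 3` blocks… in fact `9 ≤ 2k + 3`)
    have h3e : ((twoParts W k).filter fun ρ => ∀ B ∈ ρ, B.card ≤ 3).card = 0 := by
      rw [Finset.card_eq_zero, Finset.filter_eq_empty_iff]
      intro ρ hρ h3
      rcases blocks_of_mem_twoParts_add_three hW hρ with ⟨Q, hQ, hQ5, -⟩ | ⟨Q, hQ, hQ4, -⟩ | ⟨-, hthree⟩
      · have := h3 Q hQ; omega
      · have := h3 Q hQ; omega
      · have hle : ((twoParts W k).card) ≥ 0 := Nat.zero_le _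
        have hρk := (mem_twoParts.1 hρ).2.2
        have : (ρ.filter fun B => B.card = 3).card ≤ ρ.card := Finset.card_filter_le _ _
        omega
    have h9 : (2 * k + 3).choose 9 = 0 := Nat.choose_eq_zero_of_lt (by omega)
    rw [hsplit, Finset.card_union_of_disjoint hd2, Finset.card_union_of_disjoint hd1, card_twoParts_filter_quint hW, card_twoParts_filter_quad_three hW, h3e, h9]
    ring
  · have h3 := three_mul_card_threeTriples hW hk
    have hc := choose_three_three_three (2 * k + 3)
    rw [show 2 * k + 3 - 3 = 2 * k by omega] at hc
    have h3' : ((twoParts W k).filter fun ρ => ∀ B ∈ ρ, B.card ≤ 3).card = 280 * (2 * k + 3).choose 9 * (2 * k - 7).doubleFactorial := by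
      have : 3 * ((twoParts W k).filter fun ρ => ∀ B ∈ ρ, B.card ≤ 3).card = 3 * (280 * (2 * k + 3).choose 9 * (2 * k - 7).doubleFactorial) := by
        rw [h3, show (2 * k + 3).choose 3 * (10 * (2 * k).choose 6 * (2 * k - 7).doubleFactorial) =
          ((2 * k + 3).choose 3 * (10 * (2 * k).choose 6)) * (2 * k - 7).doubleFactorial by ring, hc]
        ring
      omega
    rw [hsplit, Finset.card_union_of_disjoint hd2, Finset.card_union_of_disjoint hd1, card_twoParts_filter_quint hW, card_twoParts_filter_quad_three hW, h3']

/-! ### The (A, B) sum on `2k + 3` outside positions -/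

/-- The disjoint pairs `(A, B)` with `#A + #B = 2` inside an `n`-set number `4·C(n,2)` (two subsets of size two, or an ordered pair of distinct points).
[cite: Stanley2012EC1, §1.3; lane plumbing] -/
private theorem card_disjPairs_four_choose (O : Finset (Fin m)) :
    (((O.powerset ×ˢ O.powerset).filter (fun AB : Finset (Fin m) × Finset (Fin m) => Disjoint AB.1 AB.2)).filter
        (fun AB => AB.1.card + AB.2.card = 2)).card = 4 * O.card.choose 2 := by
  classical
  have hdesc : (((O.powerset ×ˢ O.powerset).filter (fun AB : Finset (Fin m) × Finset (Fin m) => Disjoint AB.1 AB.2)).filter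
      (fun AB => AB.1.card + AB.2.card = 2)) =
      (O.powersetCard 2).image (fun t => (t, (∅ : Finset (Fin m)))) ∪ (O.powersetCard 2).image (fun t => ((∅ : Finset (Fin m)), t)) ∪
        O.offDiag.image (fun ab => (({ab.1} : Finset (Fin m)), ({ab.2} : Finset (Fin m)))) := by
    ext AB
    rw [Finset.mem_filter, Finset.mem_filter, Finset.mem_product, Finset.mem_powerset, Finset.mem_powerset, Finset.mem_union, Finset.mem_union,
      Finset.mem_image, Finset.mem_image, Finset.mem_image]
    constructor
    · rintro ⟨⟨⟨hA, hB⟩, hd⟩, hs⟩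
      rcases Nat.eq_zero_or_pos AB.2.card with h0 | hpos
      · refine Or.inl (Or.inl ⟨AB.1, Finset.mem_powersetCard.2 ⟨hA, by omega⟩, ?_⟩)
        rw [← Finset.card_eq_zero.1 h0]
      · rcases Nat.eq_zero_or_pos AB.1.card with h1 | h1pos
        · refine Or.inl (Or.inr ⟨AB.2, Finset.mem_powersetCard.2 ⟨hB, by omega⟩, ?_⟩)
          rw [← Finset.card_eq_zero.1 h1]
        · obtain ⟨a, ha'⟩ := Finset.card_eq_one.1 (show AB.1.card = 1 by omega)
          obtain ⟨b, hb'⟩ := Finset.card_eq_one.1 (show AB.2.card = 1 by omega)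
          refine Or.inr ⟨(a, b), Finset.mem_offDiag.2 ⟨hA (by rw [ha']; simp), hB (by rw [hb']; simp), fun hab => ?_⟩, ?_⟩
          · simp only at hab; rw [ha', hb', hab] at hd; simp at hd
          · rw [← ha', ← hb']
    · rintro ((⟨t, ht, rfl⟩ | ⟨t, ht, rfl⟩) | ⟨ab, hab, rfl⟩)
      · rw [Finset.mem_powersetCard] at ht
        exact ⟨⟨⟨ht.1, Finset.empty_subset _⟩, disjoint_bot_right⟩, by simp [ht.2]⟩
      · rw [Finset.mem_powersetCard] at ht
        exact ⟨⟨⟨Finset.empty_subset _, ht.1⟩, disjoint_bot_left⟩, by simp [ht.2]⟩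
      · rw [Finset.mem_offDiag] at hab
        exact ⟨⟨⟨by simpa using hab.1, by simpa using hab.2.1⟩, by simpa using hab.2.2⟩, by simp⟩
  rw [hdesc]
  have hd1 : Disjoint ((O.powersetCard 2).image (fun t => (t, (∅ : Finset (Fin m))))) ((O.powersetCard 2).image (fun t => ((∅ : Finset (Fin m)), t))) := by
    rw [Finset.disjoint_left]
    rintro AB h1 h2
    obtain ⟨t, ht, rfl⟩ := Finset.mem_image.1 h1
    obtain ⟨t', -, h⟩ := Finset.mem_image.1 h2
    rw [Finset.mem_powersetCard] at ht
    have := congrArg Prod.fst h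
    simp only at this
    rw [← this, Finset.card_empty] at ht
    omega
  have hd2 : Disjoint ((O.powersetCard 2).image (fun t => (t, (∅ : Finset (Fin m)))) ∪ (O.powersetCard 2).image (fun t => ((∅ : Finset (Fin m)), t)))
      (O.offDiag.image (fun ab => (({ab.1} : Finset (Fin m)), ({ab.2} : Finset (Fin m))))) := by
    rw [Finset.disjoint_left]
    rintro AB h1 h2
    obtain ⟨ab, -, rfl⟩ := Finset.mem_image.1 h2
    rcases Finset.mem_union.1 h1 with h1 | h1
    · obtain ⟨t, -, h⟩ := Finset.mem_image.1 h1
      have := congrArg Prod.snd h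
      simp at this
    · obtain ⟨t, -, h⟩ := Finset.mem_image.1 h1
      have := congrArg Prod.fst h
      simp at this
  rw [Finset.card_union_of_disjoint hd2, Finset.card_union_of_disjoint hd1,
    Finset.card_image_of_injective _ (fun a b h => by simpa using congrArg Prod.fst h),
    Finset.card_image_of_injective _ (fun a b h => by simpa using congrArg Prod.snd h),
    Finset.card_image_of_injective _ (fun a b h => by
      obtain ⟨a1, a2⟩ := a; obtain ⟨b1, b2⟩ := b
      simp only [Prod.mk.injEq, Finset.singleton_inj] at h
      exact Prod.ext h.1 h.2),
    Finset.card_powersetCard, Finset.offDiag_card, Nat.choose_two_right, ← Nat.mul_sub_one]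
  have h := Nat.two_mul_div_two_of_even (Nat.even_mul_pred_self O.card)
  omega

/-- The disjoint pairs `(A, B)` with `#A + #B = 3` inside an `n`-set: `2·C(n,3) + 2·C(n,2)·(n−2)`. [cite: Stanley2012EC1, §1.3; lane plumbing] -/
private theorem card_disjPairs_three (O : Finset (Fin m)) :
    (((O.powerset ×ˢ O.powerset).filter (fun AB : Finset (Fin m) × Finset (Fin m) => Disjoint AB.1 AB.2)).filter
        (fun AB => AB.1.card + AB.2.card = 3)).card = 2 * O.card.choose 3 + 2 * (O.card.choose 2 * (O.card - 2)) := by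
  classical
  set M := (O.powersetCard 2).sigma (fun s => O \ s) with hM
  have hMc : M.card = O.card.choose 2 * (O.card - 2) := by
    rw [hM, Finset.card_sigma, Finset.sum_const_nat (m := O.card - 2), Finset.card_powersetCard]
    intro s hs
    rw [Finset.mem_powersetCard] at hs
    rw [Finset.card_sdiff_of_subset hs.1, hs.2]
  have hdesc : (((O.powerset ×ˢ O.powerset).filter (fun AB : Finset (Fin m) × Finset (Fin m) => Disjoint AB.1 AB.2)).filter
      (fun AB => AB.1.card + AB.2.card = 3)) =
      (O.powersetCard 3).image (fun t => (t, (∅ : Finset (Fin m)))) ∪ (O.powersetCard 3).image (fun t => ((∅ : Finset (Fin m)), t)) ∪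
        (M.image (fun x => (x.1, ({x.2} : Finset (Fin m)))) ∪ M.image (fun x => (({x.2} : Finset (Fin m)), x.1))) := by
    ext AB
    rw [Finset.mem_filter, Finset.mem_filter, Finset.mem_product, Finset.mem_powerset, Finset.mem_powerset, Finset.mem_union, Finset.mem_union, Finset.mem_union,
      Finset.mem_image, Finset.mem_image, Finset.mem_image, Finset.mem_image]
    constructor
    · rintro ⟨⟨⟨hA, hB⟩, hd⟩, hs⟩
      rcases Nat.eq_zero_or_pos AB.2.card with h0 | hpos
      · refine Or.inl (Or.inl ⟨AB.1, Finset.mem_powersetCard.2 ⟨hA, by omega⟩, ?_⟩)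
        rw [← Finset.card_eq_zero.1 h0]
      · rcases Nat.eq_zero_or_pos AB.1.card with h1 | h1pos
        · refine Or.inl (Or.inr ⟨AB.2, Finset.mem_powersetCard.2 ⟨hB, by omega⟩, ?_⟩)
          rw [← Finset.card_eq_zero.1 h1]
        · rcases (show AB.2.card = 1 ∨ AB.1.card = 1 by omega) with hb1 | ha1
          · obtain ⟨b, hb'⟩ := Finset.card_eq_one.1 hb1
            refine Or.inr (Or.inl ⟨⟨AB.1, b⟩, ?_, ?_⟩)
            · rw [hM, Finset.mem_sigma, Finset.mem_powersetCard, Finset.mem_sdiff]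
              dsimp only
              refine ⟨⟨hA, by omega⟩, hB (by rw [hb']; simp), fun hbA => ?_⟩
              exact Finset.disjoint_left.1 hd hbA (by rw [hb']; simp)
            · rw [← hb']
          · obtain ⟨a, ha'⟩ := Finset.card_eq_one.1 ha1
            refine Or.inr (Or.inr ⟨⟨AB.2, a⟩, ?_, ?_⟩)
            · rw [hM, Finset.mem_sigma, Finset.mem_powersetCard, Finset.mem_sdiff]
              dsimp only
              refine ⟨⟨hB, by omega⟩, hA (by rw [ha']; simp), fun haB => ?_⟩
              exact Finset.disjoint_left.1 hd (by rw [ha']; simp) haB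
            · rw [← ha']
    · rintro ((⟨t, ht, rfl⟩ | ⟨t, ht, rfl⟩) | (⟨x, hx, rfl⟩ | ⟨x, hx, rfl⟩))
      · rw [Finset.mem_powersetCard] at ht
        exact ⟨⟨⟨ht.1, Finset.empty_subset _⟩, disjoint_bot_right⟩, by simp [ht.2]⟩
      · rw [Finset.mem_powersetCard] at ht
        exact ⟨⟨⟨Finset.empty_subset _, ht.1⟩, disjoint_bot_left⟩, by simp [ht.2]⟩
      · rw [hM, Finset.mem_sigma, Finset.mem_powersetCard, Finset.mem_sdiff] at hx
        refine ⟨⟨⟨hx.1.1, by simpa using hx.2.1⟩, Finset.disjoint_singleton_right.2 hx.2.2⟩, by simp [hx.1.2]⟩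
      · rw [hM, Finset.mem_sigma, Finset.mem_powersetCard, Finset.mem_sdiff] at hx
        refine ⟨⟨⟨by simpa using hx.2.1, hx.1.1⟩, Finset.disjoint_singleton_left.2 hx.2.2⟩, by simp [hx.1.2]⟩
  rw [hdesc]
  have hi1 : Function.Injective (fun t : Finset (Fin m) => (t, (∅ : Finset (Fin m)))) := fun a b h => by simpa using congrArg Prod.fst h
  have hi2 : Function.Injective (fun t : Finset (Fin m) => ((∅ : Finset (Fin m)), t)) := fun a b h => by simpa using congrArg Prod.snd h
  have hi3 : Set.InjOn (fun x : (Σ _ : Finset (Fin m), Fin m) => (x.1, ({x.2} : Finset (Fin m)))) ↑M := by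
    rintro ⟨a1, a2⟩ - ⟨b1, b2⟩ - h
    simp only [Prod.mk.injEq, Finset.singleton_inj] at h
    obtain ⟨rfl, rfl⟩ := h; rfl
  have hi4 : Set.InjOn (fun x : (Σ _ : Finset (Fin m), Fin m) => (({x.2} : Finset (Fin m)), x.1)) ↑M := by
    rintro ⟨a1, a2⟩ - ⟨b1, b2⟩ - h
    simp only [Prod.mk.injEq, Finset.singleton_inj] at h
    obtain ⟨rfl, rfl⟩ := h; rfl
  -- three-element first components vs empty vs two-element: disjointness by the cardinality of the first component
  have hcardfst : ∀ AB : Finset (Fin m) × Finset (Fin m),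
      (AB ∈ (O.powersetCard 3).image (fun t => (t, (∅ : Finset (Fin m)))) → AB.1.card = 3 ∧ AB.2.card = 0) ∧
      (AB ∈ (O.powersetCard 3).image (fun t => ((∅ : Finset (Fin m)), t)) → AB.1.card = 0 ∧ AB.2.card = 3) ∧
      (AB ∈ M.image (fun x => (x.1, ({x.2} : Finset (Fin m)))) → AB.1.card = 2 ∧ AB.2.card = 1) ∧
      (AB ∈ M.image (fun x => (({x.2} : Finset (Fin m)), x.1)) → AB.1.card = 1 ∧ AB.2.card = 2) := by
    intro AB
    refine ⟨fun h => ?_, fun h => ?_, fun h => ?_, fun h => ?_⟩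
    · obtain ⟨t, ht, rfl⟩ := Finset.mem_image.1 h; rw [Finset.mem_powersetCard] at ht; exact ⟨ht.2, Finset.card_empty⟩
    · obtain ⟨t, ht, rfl⟩ := Finset.mem_image.1 h; rw [Finset.mem_powersetCard] at ht; exact ⟨Finset.card_empty, ht.2⟩
    · obtain ⟨x, hx, rfl⟩ := Finset.mem_image.1 h; rw [hM, Finset.mem_sigma, Finset.mem_powersetCard] at hx; exact ⟨hx.1.2, Finset.card_singleton _⟩
    · obtain ⟨x, hx, rfl⟩ := Finset.mem_image.1 h; rw [hM, Finset.mem_sigma, Finset.mem_powersetCard] at hx; exact ⟨Finset.card_singleton _, hx.1.2⟩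
  have hd1 : Disjoint ((O.powersetCard 3).image (fun t => (t, (∅ : Finset (Fin m))))) ((O.powersetCard 3).image (fun t => ((∅ : Finset (Fin m)), t))) := by
    rw [Finset.disjoint_left]; intro AB h1 h2
    have := ((hcardfst AB).1 h1).1; have := ((hcardfst AB).2.1 h2).1; omega
  have hd3 : Disjoint (M.image (fun x => (x.1, ({x.2} : Finset (Fin m))))) (M.image (fun x => (({x.2} : Finset (Fin m)), x.1))) := by
    rw [Finset.disjoint_left]; intro AB h1 h2
    have := ((hcardfst AB).2.2.1 h1).1; have := ((hcardfst AB).2.2.2 h2).1; omega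
  have hd2 : Disjoint ((O.powersetCard 3).image (fun t => (t, (∅ : Finset (Fin m)))) ∪ (O.powersetCard 3).image (fun t => ((∅ : Finset (Fin m)), t)))
      (M.image (fun x => (x.1, ({x.2} : Finset (Fin m)))) ∪ M.image (fun x => (({x.2} : Finset (Fin m)), x.1))) := by
    rw [Finset.disjoint_left]; intro AB h1 h2
    rcases Finset.mem_union.1 h1 with h1 | h1 <;> rcases Finset.mem_union.1 h2 with h2 | h2
    · have := ((hcardfst AB).1 h1).1; have := ((hcardfst AB).2.2.1 h2).1; omega
    · have := ((hcardfst AB).1 h1).1; have := ((hcardfst AB).2.2.2 h2).1; omega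
    · have := ((hcardfst AB).2.1 h1).1; have := ((hcardfst AB).2.2.1 h2).1; omega
    · have := ((hcardfst AB).2.1 h1).1; have := ((hcardfst AB).2.2.2 h2).1; omega
  rw [Finset.card_union_of_disjoint hd2, Finset.card_union_of_disjoint hd1, Finset.card_union_of_disjoint hd3, Finset.card_image_of_injective _ hi1,
    Finset.card_image_of_injective _ hi2, Finset.card_image_of_injOn hi3, Finset.card_image_of_injOn hi4, Finset.card_powersetCard, hMc]
  ring

open Classical in
/-- ★★ THE (A, B) SUM ON `2k + 3` OUTSIDE POSITIONS: `Σ_{A, B ⊆ O disjoint} #twoParts (O ∖ (A ∪ B)) k = (G4) + 2(2k+3)·(G3) + 2(2k+3)(2k+2)·(G2) + 8·C(2k+3,3)·(G1)` — by `#A + #B ∈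
{0, 1, 2, 3}`; `≥ 4` leaves too few points. [cite: MadrasSlade1993, Definition 1.2.4; lane lemma] -/
theorem sum_card_twoParts_pairs_add_three {O : Finset (Fin m)} {k : ℕ} (hOc : O.card = 2 * k + 3) :
    ∑ AB ∈ (O.powerset ×ˢ O.powerset).filter (fun AB => Disjoint AB.1 AB.2), (twoParts (O \ (AB.1 ∪ AB.2)) k).card =
      ((2 * k + 3).choose 5 * (2 * k - 3).doubleFactorial + (2 * k + 3).choose 4 * ((2 * k - 1).choose 3 * (2 * k - 5).doubleFactorial) +
          280 * (2 * k + 3).choose 9 * (2 * k - 7).doubleFactorial) +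
        2 * (2 * k + 3) * ((2 * k + 2).choose 4 * (2 * k - 3).doubleFactorial + 10 * (2 * k + 2).choose 6 * (2 * k - 5).doubleFactorial) +
        2 * (2 * k + 3) * (2 * k + 2) * ((2 * k + 1).choose 3 * (2 * k - 3).doubleFactorial) + 8 * (2 * k + 3).choose 3 * (2 * k - 1).doubleFactorial := by
  set D := (O.powerset ×ˢ O.powerset).filter (fun AB : Finset (Fin m) × Finset (Fin m) => Disjoint AB.1 AB.2) with hD
  have hmemD : ∀ AB ∈ D, AB.1 ⊆ O ∧ AB.2 ⊆ O ∧ Disjoint AB.1 AB.2 := by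
    intro AB hAB
    rw [hD, Finset.mem_filter, Finset.mem_product, Finset.mem_powerset, Finset.mem_powerset] at hAB
    exact ⟨hAB.1.1, hAB.1.2, hAB.2⟩
  have hrest : ∀ AB ∈ D, (O \ (AB.1 ∪ AB.2)).card = 2 * k + 3 - (AB.1.card + AB.2.card) := by
    intro AB hAB
    obtain ⟨hA, hB, hd⟩ := hmemD AB hAB
    rw [Finset.card_sdiff_of_subset (Finset.union_subset hA hB), Finset.card_union_of_disjoint hd, hOc]
  have hval : ∀ AB ∈ D, (twoParts (O \ (AB.1 ∪ AB.2)) k).card =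
      if AB.1.card + AB.2.card = 0 then (2 * k + 3).choose 5 * (2 * k - 3).doubleFactorial + (2 * k + 3).choose 4 * ((2 * k - 1).choose 3 * (2 * k - 5).doubleFactorial) +
          280 * (2 * k + 3).choose 9 * (2 * k - 7).doubleFactorial
      else if AB.1.card + AB.2.card = 1 then (2 * k + 2).choose 4 * (2 * k - 3).doubleFactorial + 10 * (2 * k + 2).choose 6 * (2 * k - 5).doubleFactorial
      else if AB.1.card + AB.2.card = 2 then (2 * k + 1).choose 3 * (2 * k - 3).doubleFactorial
      else if AB.1.card + AB.2.card = 3 then (2 * k - 1).doubleFactorial else 0 := by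
    intro AB hAB
    have hc := hrest AB hAB
    split_ifs with h0 h1 h2 h3
    · exact card_twoParts_of_card_eq_add_three (by rw [hc, h0]; omega)
    · exact card_twoParts_of_card_eq_add_two (by rw [hc, h1]; omega)
    · exact card_twoParts_of_card_eq_succ (by rw [hc, h2]; omega)
    · exact card_twoParts_of_card_eq (by rw [hc, h3]; omega)
    · obtain ⟨hA, hB, hd⟩ := hmemD AB hAB
      have hle := Finset.card_le_card (Finset.union_subset hA hB)
      rw [Finset.card_union_of_disjoint hd, hOc] at hle
      rw [twoParts_eq_empty_of_lt (by rw [hc]; omega), Finset.card_empty]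
  rw [Finset.sum_congr rfl hval]
  -- evaluate the sum of the step function by the four classes
  rw [Finset.sum_ite, Finset.sum_const, smul_eq_mul, Finset.sum_ite, Finset.sum_const, smul_eq_mul, Finset.sum_ite, Finset.sum_const, smul_eq_mul, Finset.sum_ite,
    Finset.sum_const, smul_eq_mul, Finset.sum_const_zero, add_zero]
  -- the four cardinalities
  have hD0 : (D.filter (fun AB => AB.1.card + AB.2.card = 0)).card = 1 := by
    rw [Finset.card_eq_one]
    refine ⟨(∅, ∅), ?_⟩
    ext AB
    rw [Finset.mem_filter, Finset.mem_singleton, hD, Finset.mem_filter, Finset.mem_product, Finset.mem_powerset, Finset.mem_powerset]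
    constructor
    · rintro ⟨-, h⟩; exact Prod.ext (Finset.card_eq_zero.1 (by omega)) (Finset.card_eq_zero.1 (by omega))
    · rintro rfl; simp
  have hD1 : ((D.filter fun AB => ¬ AB.1.card + AB.2.card = 0).filter (fun AB => AB.1.card + AB.2.card = 1)).card = 2 * (2 * k + 3) := by
    have heq : ((D.filter fun AB => ¬ AB.1.card + AB.2.card = 0).filter (fun AB => AB.1.card + AB.2.card = 1)) =
        O.image (fun o => (({o} : Finset (Fin m)), (∅ : Finset (Fin m)))) ∪ O.image (fun o => (∅, {o})) := by
      ext AB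
      rw [Finset.mem_filter, Finset.mem_filter, Finset.mem_union, Finset.mem_image, Finset.mem_image, hD, Finset.mem_filter, Finset.mem_product, Finset.mem_powerset,
        Finset.mem_powerset]
      constructor
      · rintro ⟨⟨⟨⟨hA, hB⟩, -⟩, -⟩, hs⟩
        rcases Nat.eq_zero_or_pos AB.1.card with h1 | h1
        · obtain ⟨o, ho⟩ := Finset.card_eq_one.1 (show AB.2.card = 1 by omega)
          refine Or.inr ⟨o, hB (by rw [ho]; simp), ?_⟩
          rw [← ho, ← Finset.card_eq_zero.1 h1]
        · obtain ⟨o, ho⟩ := Finset.card_eq_one.1 (show AB.1.card = 1 by omega)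
          refine Or.inl ⟨o, hA (by rw [ho]; simp), ?_⟩
          rw [← ho, ← Finset.card_eq_zero.1 (show AB.2.card = 0 by omega)]
      · rintro (⟨o, ho, rfl⟩ | ⟨o, ho, rfl⟩)
        · exact ⟨⟨⟨⟨by simpa using ho, Finset.empty_subset _⟩, by simp⟩, by simp⟩, by simp⟩
        · exact ⟨⟨⟨⟨Finset.empty_subset _, by simpa using ho⟩, by simp⟩, by simp⟩, by simp⟩
    have hdisj1 : Disjoint (O.image (fun o => (({o} : Finset (Fin m)), (∅ : Finset (Fin m))))) (O.image (fun o => (∅, {o}))) := by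
      rw [Finset.disjoint_left]
      rintro AB h1 h2
      obtain ⟨o, -, rfl⟩ := Finset.mem_image.1 h1
      obtain ⟨o', -, h⟩ := Finset.mem_image.1 h2
      have := congrArg Prod.fst h
      simp at this
    rw [heq, Finset.card_union_of_disjoint hdisj1, Finset.card_image_of_injective _ (fun a b h => by simpa using congrArg Prod.fst h),
      Finset.card_image_of_injective _ (fun a b h => by simpa using congrArg Prod.snd h), hOc]
    ring
  have hD2 : (((D.filter fun AB => ¬ AB.1.card + AB.2.card = 0).filter (fun AB => ¬ AB.1.card + AB.2.card = 1)).filter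
      (fun AB => AB.1.card + AB.2.card = 2)).card = 2 * (2 * k + 3) * (2 * k + 2) := by
    have heq : (((D.filter fun AB => ¬ AB.1.card + AB.2.card = 0).filter (fun AB => ¬ AB.1.card + AB.2.card = 1)).filter
        (fun AB => AB.1.card + AB.2.card = 2)) = D.filter (fun AB => AB.1.card + AB.2.card = 2) := by
      ext AB; simp only [Finset.mem_filter]; constructor
      · rintro ⟨⟨⟨h, -⟩, -⟩, h2⟩; exact ⟨h, h2⟩
      · rintro ⟨h, h2⟩; exact ⟨⟨⟨h, by omega⟩, by omega⟩, h2⟩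
    rw [heq, hD, card_disjPairs_four_choose O, hOc, Nat.choose_two_right]
    have h2 : (2 * k + 3) * (2 * k + 3 - 1) / 2 = (2 * k + 3) * (k + 1) := by
      rw [show 2 * k + 3 - 1 = 2 * k + 2 by omega, show (2 * k + 3) * (2 * k + 2) = (2 * k + 3) * (k + 1) * 2 by ring, Nat.mul_div_cancel _ two_pos]
    rw [h2]
    ring
  have hD3 : ((((D.filter fun AB => ¬ AB.1.card + AB.2.card = 0).filter (fun AB => ¬ AB.1.card + AB.2.card = 1)).filter
      (fun AB => ¬ AB.1.card + AB.2.card = 2)).filter (fun AB => AB.1.card + AB.2.card = 3)).card = 8 * (2 * k + 3).choose 3 := by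
    have heq : ((((D.filter fun AB => ¬ AB.1.card + AB.2.card = 0).filter (fun AB => ¬ AB.1.card + AB.2.card = 1)).filter
        (fun AB => ¬ AB.1.card + AB.2.card = 2)).filter (fun AB => AB.1.card + AB.2.card = 3)) = D.filter (fun AB => AB.1.card + AB.2.card = 3) := by
      ext AB; simp only [Finset.mem_filter]; constructor
      · rintro ⟨⟨⟨⟨h, -⟩, -⟩, -⟩, h3⟩; exact ⟨h, h3⟩
      · rintro ⟨h, h3⟩; exact ⟨⟨⟨⟨h, by omega⟩, by omega⟩, by omega⟩, h3⟩
    rw [heq, hD, card_disjPairs_three O, hOc]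
    -- `2C(n,3) + 2C(n,2)(n−2) = 8C(n,3)`: `C(n,2)(n−2) = 3C(n,3)`
    have h3 : (2 * k + 3).choose 2 * (2 * k + 3 - 2) = 3 * (2 * k + 3).choose 3 := by
      have h := Nat.choose_mul (n := 2 * k + 3) (k := 3) (s := 2) (by norm_num)
      rw [show Nat.choose 3 2 = 3 by decide, show 3 - 2 = 1 by norm_num, Nat.choose_one_right] at h
      rw [mul_comm] at h
      omega
    rw [h3]; ring
  rw [hD0, hD1, hD2, hD3]
  ring

/-! ### The lowest corner on `2j − 3` letters -/

/-- The FOURTH-LAYER LOWEST CONSTANT `Q_j = #goodParts (2j−3) j p` (any `p`): `(G4) + 2(2k+3)(G3) + 2(2k+3)(2k+2)(G2) + 8C(2k+3,3)(G1)` at `k = j − 5`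
(`8, 131, 2086, 35938` for `j = 5…8`). [cite: MadrasSlade1993, Definition 1.2.4; lane tool notion] -/
def fourthLowQ (j : ℕ) : ℕ :=
  ((2 * j - 7).choose 5 * (2 * j - 13).doubleFactorial + (2 * j - 7).choose 4 * ((2 * j - 11).choose 3 * (2 * j - 15).doubleFactorial) +
      280 * (2 * j - 7).choose 9 * (2 * j - 17).doubleFactorial) +
    2 * (2 * j - 7) * ((2 * j - 8).choose 4 * (2 * j - 13).doubleFactorial + 10 * (2 * j - 8).choose 6 * (2 * j - 15).doubleFactorial) +
    2 * (2 * j - 7) * (2 * j - 8) * ((2 * j - 9).choose 3 * (2 * j - 13).doubleFactorial) + 8 * (2 * j - 7).choose 3 * (2 * j - 11).doubleFactorial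

section Count

variable {p : ℕ}

open Classical in
/-- ★★ THE (A, B, ρ) COUNT ON `2j − 3` LETTERS: `#abData (2j−3) j p = Q_j` (`j ≥ 5`). [cite: MadrasSlade1993, Definition 1.2.4; lane theorem] -/
theorem card_abData_fourthLow {j : ℕ} (hj : 5 ≤ j) (hp : p + 4 ≤ 2 * j - 3) :
    (abData (2 * j - 3) j p hp).card = fourthLowQ j := by
  obtain ⟨k, rfl⟩ : ∃ k, j = k + 5 := ⟨j - 5, by omega⟩
  unfold abData fourthLowQ
  rw [Finset.card_sigma, show 2 * (k + 5) - 3 - (k + 5) - 2 = k by omega,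
    sum_card_twoParts_pairs_add_three (k := k) (by rw [card_outerPos hp]; omega)]
  have e7 : 2 * (k + 5) - 7 = 2 * k + 3 := by omega
  have e8 : 2 * (k + 5) - 8 = 2 * k + 2 := by omega
  have e9 : 2 * (k + 5) - 9 = 2 * k + 1 := by omega
  have e11 : 2 * (k + 5) - 11 = 2 * k - 1 := by omega
  have e13 : 2 * (k + 5) - 13 = 2 * k - 3 := by omega
  have e15 : 2 * (k + 5) - 15 = 2 * k - 5 := by omega
  have e17 : 2 * (k + 5) - 17 = 2 * k - 7 := by omega
  rw [e7, e8, e9, e11, e13, e15, e17]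

/-- ★★★ THE FOURTH-LAYER LOWEST CLASS COUNT: `#shapeClass j (2j−3) (topVec (2j−3) p) = Q_j · 2^{2j−5}` for every `p + 4 ≤ 2j − 3`, `j ≥ 5` (independent of `p`;
`256, 16768, 1068032, 73601024` per position for `j = 5…8`). [cite: MadrasSlade1993, Definition 1.2.4; lane theorem] -/
theorem card_shapeClass_fourthLow {j p : ℕ} (hj : 5 ≤ j) (hp : p + 4 ≤ 2 * j - 3) :
    (shapeClass j (2 * j - 3) (topVec (2 * j - 3) p)).card = fourthLowQ j * 2 ^ (2 * j - 5) := by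
  rw [card_shapeClass_topVec hp, card_goodParts_eq_card_abData hp (by omega), card_abData_fourthLow hj hp, show 2 * j - 3 - 2 = 2 * j - 5 by omega]

open Classical in
/-- The FOURTH-LAYER LOWEST SUM `M_j(2j−3, 2j−6) = Σ_{A valid on 2j − 3 letters, breaks A = 2j − 6} #shapeClass_j(2j−3, A)` (one run of four).
[cite: MadrasSlade1993, Definition 1.2.4; lane tool notion] -/
noncomputable def fourthShapeSumLow (j : ℕ) : ℕ :=
  ∑ A : Fin (2 * j - 3) → Bool, if AdjValid A ∧ breaks A = 2 * j - 6 then (shapeClass j (2 * j - 3) A).card else 0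

open Classical in
/-- ★★★ THE FOURTH-LAYER LOWEST CENSUS FOR EVERY `j ≥ 5`: `M_j(2j−3, 2j−6) = (2j−6)·Q_j·2^{2j−5}` — the classes with `2j − 6` breaks on `2j − 3` letters are the one-block
classes
`topVec (2j−3) p`, `p ≤ 2j − 7` (λ1), each counted above (`1024, 100608, 8544256, 736010240` for `j = 5, …, 8`; the last two ≡ FINDING §18's `M_7(11,8)`, `M_8(13,10)`).
[cite: MadrasSlade1993, §1.1 eq. (1.1.8) p. 5; Definition 1.2.4] [cite: ClisbyLiangSlade2007, §3.3 eqs. (29)/(31); lane theorem] -/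
theorem fourthShapeSumLow_eq (j : ℕ) (hj : 5 ≤ j) :
    fourthShapeSumLow j = (2 * j - 6) * (fourthLowQ j * 2 ^ (2 * j - 5)) := by
  unfold fourthShapeSumLow
  have hval : ∀ p ∈ Finset.range (2 * j - 6),
      (if AdjValid (topVec (2 * j - 3) p) ∧ breaks (topVec (2 * j - 3) p) = 2 * j - 6 then (shapeClass j (2 * j - 3) (topVec (2 * j - 3) p)).card
        else 0) = fourthLowQ j * 2 ^ (2 * j - 5) := by
    intro p hp
    rw [Finset.mem_range] at hp
    have hp4 : p + 4 ≤ 2 * j - 3 := by omega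
    rw [if_pos ⟨adjValid_topVec hp4, by rw [breaks_topVec hp4]; omega⟩, card_shapeClass_fourthLow hj hp4]
  have hvan : ∀ A ∈ (Finset.univ : Finset (Fin (2 * j - 3) → Bool)), A ∉ (Finset.range (2 * j - 6)).image (topVec (2 * j - 3)) →
      (if AdjValid A ∧ breaks A = 2 * j - 6 then (shapeClass j (2 * j - 3) A).card else 0) = 0 := by
    intro A _ hA
    split_ifs with h
    · by_contra hne
      obtain ⟨κ, hκ⟩ := Finset.card_pos.1 (Nat.pos_of_ne_zero hne)
      obtain ⟨p, hp4, rfl⟩ := exists_eq_topVec_of_mem_shapeClass (by rw [h.2]; omega) hκ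
      exact hA (Finset.mem_image.2 ⟨p, Finset.mem_range.2 (by omega), rfl⟩)
    · rfl
  have hinj : Set.InjOn (topVec (2 * j - 3)) ↑(Finset.range (2 * j - 6)) := by
    intro p hp p' hp' h
    rw [Finset.mem_coe, Finset.mem_range] at hp hp'
    exact topVec_injOn (by omega) (by omega) h
  rw [← Finset.sum_subset (Finset.subset_univ _) hvan, Finset.sum_image hinj, Finset.sum_congr rfl hval, Finset.sum_const, Finset.card_range,
    smul_eq_mul]

/-- The instances `j = 5, …, 8`: `1024`, `100608`, `8 544 256` (= `M_7(11,8)`), `736 010 240` (= `M_8(13,10)`). [cite: MadrasSlade1993, Definition 1.2.4; lane theorem] -/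
theorem fourthShapeSumLow_values :
    fourthShapeSumLow 5 = 1024 ∧ fourthShapeSumLow 6 = 100608 ∧ fourthShapeSumLow 7 = 8544256 ∧ fourthShapeSumLow 8 = 736010240 := by
  refine ⟨?_, ?_, ?_, ?_⟩ <;> rw [fourthShapeSumLow_eq _ (by norm_num)] <;> decide

end Count

end WordTypes

end Literature.Probability.RandomPlanarGeometry.SAW.Zd
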